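import Summits.ValiantsHypothesis.ValiantsHypothesis.Theorems.BarrierLeverIntegerBoxVanishingTransferSeedGrid

/-!
# Route BarrierLever — item `IntegerBoxVanishingTransfer` (stmt-ValiantsHypothesis-20033), part 2/3:
# the seed specialisations of the explicit generator at integer seeds have small integer
# coefficients; the integer box of quadratic bit-length decides vanishing on `SmallCircuits ℂ n b`

Continuation of `…IntegerBoxVanishingTransferSeedGrid.lean` (§1–§4b there).

* §4c (`intBox`, `bnd` are defined in part 1) `eval_gen_int` (the explicit generator at an integer seed `|y| ≤ h`
  takes integer values `≤ bnd n b h`), `seedSpec_mem_intBox`, `seedSpec_mem_smallCircuits` (INTO: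
  the seed specialisation of `Γ` lies in `SmallCircuits ℂ n (5b+23)` for `n ≥ 21876·2^(5b+21)+1`);
* §4d `vanishes_of_vanishes_on_intBox` — for such `n`, a level-`a` distinguisher vanishing on the
  members of `SmallCircuits ℂ n (5b+23)` with integer coefficients `≤ bnd n b (N^a (n+1))`
  vanishes on all of `SmallCircuits ℂ n b`;
* **`integerBoxVanishingTransfer`** = the signature of item stmt-ValiantsHypothesis-20033 VERBATIM
  (the box written out: `((n + n·4(n+1)(n^b+n+2)(n+1)²)·(C(2n,n)^a (n+1)))^(2n+1)`).

Reading (cell memo ROUTE-MEMO-p2 / item text): any failure of FSV Question 6 (= a relative natural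
proof) must already show on integer circuits of QUADRATIC bit-length `≈ 4a n² + O(b n log n)`, while
Chatterjee–Kumar–Ramya–Saptharishi–Tengse 2020 (Thm 1.1 + §4) construct relative natural proofs on
every slice of LINEAR bit-length: the coefficient-axis door is linear-vs-quadratic.

Lean text authored by the cell planner seat `valiant-natproofs-p2` (gen 6, HOME/IntSlice-p2g6.lean,
rc 0), ported by the prover seat.

WHAT THIS IS NOT: not a decision of Question 6 / crux stmt-14610 in either direction; CKRST 2020 is
cited context only; nothing about `VP` vs `VNP`.

References: [ForbesShpilkaVolk2018] Lemmas 13–14; Raz 2010 via the tree's `RazUniversalCircuits`.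
-/

-- layout Summits/ValiantsHypothesis/ValiantsHypothesis forces the duplicated namespace component
set_option linter.dupNamespace false

noncomputable section

namespace Summit.ValiantsHypothesis.ValiantsHypothesis.Theorems.BarrierLever.IntSlice

open Literature.Barriers.ValiantsHypothesis Literature.Computability.AlgebraicComplexity MvPolynomial
open Summit.ValiantsHypothesis.ValiantsHypothesis.Theorems.BarrierLever.SuccinctHittingSetsForVP
open Summit.ValiantsHypothesis.ValiantsHypothesis.Theorems.BarrierLever.SuccinctHittingSetsForVP.JointGen

/-! ### §4c The seed specialisations of `Γ` at integer seeds have small integer coefficients -/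

/-- `#BIdx ≤ n + n·wd n b` at every level `k ≤ n`. -/
theorem card_bIdx_le {n b : ℕ} (k : Fin (n + 1)) :
    Fintype.card (RazUniversal.BIdx (Fin n) (k : ℕ) (wd n b)) ≤ n + n * wd n b := by
  rw [card_bIdx, Fintype.card_fin]
  have hk : (k : ℕ) ≤ n := Nat.lt_succ_iff.mp k.isLt
  gcongr

/-- **The generator at an integer seed**: every coordinate `gen n b m (y)` with `|y_i| ≤ h`
(`1 ≤ h`, `1 ≤ n`) is an integer of absolute value `≤ bnd n b h`. -/
theorem eval_gen_int {n b : ℕ} (hn : 1 ≤ n) (y : Fin (q n b) → ℤ) {h : ℕ} (hh : 1 ≤ h)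
    (hy : ∀ i, |y i| ≤ h) (m : degLEMonomials n) :
    ∃ z : ℤ, eval (fun i => (y i : ℂ)) (gen n b m) = z ∧ |z| ≤ bnd n b h := by
  classical
  have hpos : 0 < n + n * wd n b := lt_of_lt_of_le hn (Nat.le_add_right _ _)
  have hbase : 1 ≤ (n + n * wd n b) * h := Nat.mul_pos hpos hh
  have hnat : h ≤ bnd n b h := by
    unfold bnd
    calc h ≤ (n + n * wd n b) * h := Nat.le_mul_of_pos_left h hpos
      _ ≤ ((n + n * wd n b) * h) ^ (2 * n + 1) := Nat.le_self_pow (by omega) _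
  rw [gen, eval_rename]
  simp only [gen₀]
  split_ifs with h0
  · rw [eval_X]
    exact ⟨y (enum n b (Sum.inl ())), rfl, (hy _).trans (by exact_mod_cast hnat)⟩
  · rw [eval_rename]
    have hk1 : 1 ≤ ((lvl m : Fin (n + 1)) : ℕ) := Nat.one_le_iff_ne_zero.mpr h0
    set Yk : LabK n b (lvl m) → ℤ := fun l => y (enum n b (Sum.inr ⟨lvl m, l⟩)) with hYk
    have hfun : ((fun i => (y i : ℂ)) ∘ enum n b) ∘ (fun l : LabK n b (lvl m) => (Sum.inr ⟨lvl m, l⟩ : Seed n b))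
        = fun l => (Yk l : ℂ) := rfl
    rw [hfun, ← RazUniversal.coeff_outVal]
    obtain ⟨z, hz, hzB⟩ := coeff_outVal_int (σ := Fin n) hk1 Yk h (fun l => hy _) (m : Fin n →₀ ℕ)
    refine ⟨z, hz, hzB.trans ?_⟩
    unfold bnd
    have hM := card_bIdx_le (n := n) (b := b) (lvl m)
    have hkn : ((lvl m : Fin (n + 1)) : ℕ) ≤ n := Nat.lt_succ_iff.mp (lvl m).isLt
    calc ((Fintype.card (RazUniversal.BIdx (Fin n) ((lvl m : Fin (n + 1)) : ℕ) (wd n b)) * h : ℕ) : ℤ)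
            ^ (2 * ((lvl m : Fin (n + 1)) : ℕ) - 1)
        ≤ ((((n + n * wd n b) * h) : ℕ) : ℤ) ^ (2 * ((lvl m : Fin (n + 1)) : ℕ) - 1) := by
          gcongr
      _ ≤ ((((n + n * wd n b) * h) : ℕ) : ℤ) ^ (2 * n + 1) := by
          exact_mod_cast Nat.pow_le_pow_right hbase (by omega)
      _ = _ := by push_cast; ring

/-- The seed specialisation `Γ(x, y)` at an integer seed lies in the integer box `bnd n b h`. -/
theorem seedSpec_mem_intBox {n b : ℕ} (hn : 1 ≤ n) (y : Fin (q n b) → ℤ) {h : ℕ} (hh : 1 ≤ h)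
    (hy : ∀ i, |y i| ≤ h) :
    aeval (Sum.elim X fun j => C ((y j : ℂ))) (gamma n b) ∈ intBox n (bnd n b h) := by
  intro m
  by_cases hm : m.degree ≤ n
  · obtain ⟨z, hz, hzB⟩ := eval_gen_int hn y hh hy ⟨m, hm⟩
    exact ⟨z, by rw [← hz]; exact coeff_seedSpec_gamma (fun j => (y j : ℂ)) ⟨m, hm⟩, hzB⟩
  · refine ⟨0, ?_, by simp⟩
    rw [Int.cast_zero]
    refine coeff_eq_zero_of_totalDegree_lt ?_
    refine lt_of_le_of_lt (totalDegree_seedSpec_gamma_le _) ?_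
    rw [← Finsupp.degree_apply]
    exact lt_of_not_ge hm

/-- The seed specialisation lies in `SmallCircuits ℂ n (5b+23)` (the INTO half of `into_gen`). -/
theorem seedSpec_mem_smallCircuits {n b : ℕ} (hn : 21876 * 2 ^ (5 * b + 21) + 1 ≤ n)
    (y : Fin (q n b) → ℂ) :
    aeval (Sum.elim X fun j => C (y j)) (gamma n b) ∈ SmallCircuits ℂ n (5 * b + 23) := by
  refine ⟨totalDegree_seedSpec_gamma_le y, ?_⟩
  have hproj : IsProjection (aeval (Sum.elim X fun j => C (y j)) (gamma n b)) (gamma n b) := by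
    refine ⟨Sum.elim X fun j => C (y j), fun i => ?_, rfl⟩
    cases i with
    | inl i => exact Or.inl ⟨i, rfl⟩
    | inr j => exact Or.inr ⟨y j, rfl⟩
  exact (complexity_le_of_isProjection hproj).trans
    ((complexity_gamma_le n b).trans (UniversalJoint.size_le_pow b n hn))

/-! ### §4d Coefficient-axis collapse, box form -/

/-- **Coefficient-axis collapse (integer box form).** For `n ≥ 21876·2^(5b+21)+1`: a level-`a`
distinguisher vanishing on the members of `SmallCircuits ℂ n (5b+23)` whose coefficients are
INTEGERS of absolute value `≤ bnd n b (N^a (n+1))` (bit-length `O(a n² + b n log n)`) vanishes on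
all of `SmallCircuits ℂ n b`. [cite: ForbesShpilkaVolk2018, Lemmas 13–14] -/
theorem vanishes_of_vanishes_on_intBox {n b a : ℕ} (hn : 21876 * 2 ^ (5 * b + 21) + 1 ≤ n)
    {D : MvPolynomial (degLEMonomials n) ℂ} (hD : D ∈ Distinguishers ℂ n a)
    (hvan : ∀ f ∈ SmallCircuits ℂ n (5 * b + 23),
      f ∈ intBox n (bnd n b ((Nat.choose (2 * n) n) ^ a * (n + 1))) →
        eval (coeffVector (degLEMonomials n) f) D = 0) :
    ∀ f ∈ SmallCircuits ℂ n b, eval (coeffVector (degLEMonomials n) f) D = 0 := by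
  have hn1 : 1 ≤ n := le_trans (Nat.le_add_left 1 _) hn
  have hh : 1 ≤ (Nat.choose (2 * n) n) ^ a * (n + 1) :=
    Nat.mul_pos (Nat.pow_pos (Nat.choose_pos (by omega))) (Nat.succ_pos n)
  refine vanishes_of_vanishes_on_intSeedGrid hD (h := (Nat.choose (2 * n) n) ^ a * (n + 1))
    (by ring_nf; omega) (fun y hy => ?_)
  have hcv : (fun m => eval (fun i => (y i : ℂ)) (gen n b m)) =
      coeffVector (degLEMonomials n) (aeval (Sum.elim X fun j => C ((y j : ℂ))) (gamma n b)) := by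
    funext m
    rw [coeffVector_apply, coeff_seedSpec_gamma]
  rw [hcv]
  exact hvan _ (seedSpec_mem_smallCircuits hn _) (seedSpec_mem_intBox hn1 y hh hy)

/-! ### The ledger item -/

/-- **Item `IntegerBoxVanishingTransfer` (stmt-ValiantsHypothesis-20033), signature verbatim.** For
`n ≥ 21876·2^(5b+21)+1`, a level-`a` distinguisher `D` that vanishes on every member of
`SmallCircuits ℂ n (5b+23)` whose coefficients are INTEGERS of absolute value
`≤ ((n + n·wd)·C(2n,n)^a·(n+1))^(2n+1)`, `wd = 4(n+1)(n^b+n+2)(n+1)²` (Raz width), vanishes on all of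
`SmallCircuits ℂ n b`. Proof: `vanishes_of_vanishes_on_intBox` (the box is `bnd n b (N^a (n+1))` by
`rfl`). -/
theorem integerBoxVanishingTransfer :
    ∀ a b n : ℕ, 21876 * 2 ^ (5 * b + 21) + 1 ≤ n →
      ∀ D ∈ Literature.Barriers.ValiantsHypothesis.Distinguishers ℂ n a,
        (∀ f ∈ Literature.Barriers.ValiantsHypothesis.SmallCircuits ℂ n (5 * b + 23),
          (∀ m : Fin n →₀ ℕ, ∃ z : ℤ, MvPolynomial.coeff m f = (z : ℂ) ∧
            |z| ≤ ((((n + n * (4 * ((n + 1) * (n ^ b + n + 2)) * (n + 1) ^ 2)) *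
              ((2 * n).choose n ^ a * (n + 1))) ^ (2 * n + 1) : ℕ) : ℤ)) →
          MvPolynomial.eval (Literature.Barriers.ValiantsHypothesis.coeffVector
            (Literature.Barriers.ValiantsHypothesis.degLEMonomials n) f) D = 0) →
        ∀ f ∈ Literature.Barriers.ValiantsHypothesis.SmallCircuits ℂ n b,
          MvPolynomial.eval (Literature.Barriers.ValiantsHypothesis.coeffVector
            (Literature.Barriers.ValiantsHypothesis.degLEMonomials n) f) D = 0 :=
  fun _a _b _n hn _D hD h => vanishes_of_vanishes_on_intBox hn hD h

end Summit.ValiantsHypothesis.ValiantsHypothesis.Theorems.BarrierLever.IntSlice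

end
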